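import Literature.MathematicalPhysics.QuantumFieldTheory.Balaban1983to89.B9Eq3115KnitLetterY
import Literature.MathematicalPhysics.QuantumFieldTheory.Balaban1983to89.B7Prop4LinCovIterClosedLaws
import Literature.MathematicalPhysics.QuantumFieldTheory.Balaban1983to89.B9C2FormBoxRegimeY
import Literature.MathematicalPhysics.QuantumFieldTheory.Balaban1983to89.B9Eq326DeltaALocalityZd

/-!
# `Balaban1983to89.B9Eq3124HZKnitPairReg335Y` — T. Bałaban, *Propagators for lattice gauge theories in a background field*, Commun. Math. Phys. **99** (1985)
# 389–434 [Balaban1985BackgroundPropagators] (3.35) p. 396, (3.115) p. 418, (3.124) p. 420, p. 426; T. Bałaban, *Averaging operations for lattice gauge theories*,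
# Commun. Math. Phys. **98** (1985) 17–51 [Balaban1985Averaging] Prop. 2 (52)–(54) p. 26 with its locality sentence, p. 24: ★★★ **`hZ` AT THE KNIT PAIR UNDER
# PRINT's LOCAL CLASS (3.35)** — `Q(U) ∘ D_U ∘ G′(U) ∘ R(U) = 0` for `Q = QknitY`, `G′, R` at `parKnitY`, for EVERY background of the k-level member's class
# `(bg9KP …).Reg335 c₀ α₀` (the certificate's binder), by RETRACTION to the double block of each index bond and LOCALITY of the letters

statement-level skeleton of published theorems with citation tags; proofs where landed; nothing here is a claim about the
Yang–Mills mass gap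

PDFs held: `paper:balaban1985-cmp99-background-propagators` (p. 396 read this seat from the text layer), `paper:balaban1985-cmp98-averaging`.

CITATION HEADER (lean-in-tree rule).  Cell `pub-ymgap`, seat `pub-ymgap-dag-n06-l` (gen 35; K1⁹ `stmt-QuantumFields-27364` SUPPORTS lane), programme P-Q15 file 5 —
the twin, for the averaging letter, of this lineage's g34 road `B9C2FormBoxRegimeY` ⟶ `B9C2FormMajTorusLettersY` for the `C⁽²⁾` letter: the GLOBAL small-plaquette
hypothesis `pdev (liftCfg U) < α₀′L^{−2k}` of file 2's `QknitY_gradY_GpPhysY_RY_parKnitY` is NOT a consequence of (3.35) (in `Λ_j`-territory the plaquettes are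
only `≲ K_pl·(L^{j−1})⁻²`), so the certificate's `hZ` — quantified over (3.35) — needs THIS file.  REUSED BY NAME: files 1–3 (`linCovIterC ∕ eq3115C ∕
linCovIterC_congr`, `QknitY ∕ liftBd_gradY ∕ QprimeIter_liftL_zSrc(_add_e)_eq_zero ∕ zSrc`), g34 (`B9C2FormBoxRegimeY.Kpl ∕ scale_slack ∕ lo_le_hi_box ∕
norm_hol_readY_plaqWord_sub_one_le_of_reg335P`, `B7Eq52RetractionExtension.retrCfg ∕ retrCfg_eq_of_bondIn ∕ retrCfg_mem ∕ pdev_retrCfg_lt`, `B9C2LettersTorusY.readY ∕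
zOf`), n06-j∕n06-c (`B9Eq335CoveragePAtLettersY.norm_holY_sub_one_le_levelled_of_reg335P`, `B9BackgroundsKLevelV1P.bg9KP ∕ mem_of_reg335P`), J-B (`parKnitY ∕ parOfT ∕
knitT ∕ compT ∕ compT_mem ∕ hol_liftCfg_plaqWord ∕ hol_plaqWord_swap ∕ mem_XB_of_blk_eq ∕ boxEquiv_transl_of_mem ∕ QpY_GpY_RY_parKnitY`), the N05 chain's localities
(`B8Ineq159CurvedCubeMemberLocalTower.bgT_congr_bg`, `B9Eq326DeltaALocalityZd.QprimeIter_bgT_congr_bg`), b07 (`avgIter_mem ∕ Wcx_avgIter_lt_one ∕ avgClosed_unitaryUnits ∕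
AgreeOn ∕ loK ∕ bondHiK`).

THE PRINT.  [B9] (3.35) p. 396: *«for an arbitrary cube □ of the described above class … there exists a gauge transformation u on □ such that U^u = e^{iηA}, and if
the index of □ is j, then |A| < O(1)Mα₀(Lʲη)⁻¹, |∇^η A| < O(1)Mα₀(Lʲη)⁻² on □»*; p. 426: *«QG₁DR = QDG′R = D̄₁Q′G′R = 0»*.  [5] Prop. 2 p. 26 + p. 24: the `k`-fold
averages are local («Ū^k_c … depends only on the bond variables U_b for b ⊂ B^k(c₋) ∪ B^k(c₊)»), so (52) is only needed on that double block.

THE ARGUMENT.  (i) KNIT LEGS ON THE CLASS: the leg `U(Γ^{(j)}_{y,w})` to a box site `w` of a block `s = (j, y) ∈ 𝔅` is the composite of [B8]'s block transporters of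
the AVERAGED backgrounds `Ū^i`, `i < j`, along contours inside `B^j(y)` — a function of `U` on that block only (`compT_bgT_congr`); on the block every fine site has
level `j`, so every plaquette there is within `K_pl·(L^{j−1})⁻² ≤ K_pl·L⁴·(Lʲ)⁻²` of `1`; the RETRACTION of `U♯` to the block satisfies [5]'s global (52) at scale `j`
(`pdev_retrCfg_lt`), its averages are `U(N)`-valued (`avgIter_mem`, `U(N)` averaging-closed), hence so is the leg: `parKnitY U` is `U(N)`-valued and J-B's «Q′G′R = 0»
applies.  (ii) PER INDEX BOND `ι` (level `j`): `(Q(U)(D_UΦ))(ι)` reads `U♯` and `(D_UΦ)♯` on the double block `B^j(ι₋) ∪ B^j(ι₊)` only (file 3), `(D_UΦ)♯ = c_f·D¹_{U♯}Φ♯`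
reads `U♯` bondwise, so both may be replaced by the retraction `Û_ι`; there every site has level `≥ j − 1` (g34), `pdev Û_ι < α₀′(Lʲ)⁻²`, so (3.115) holds for
`Û_ι` at level `j` (`eq3115C`), giving `R(·)(Q′_j(Û_ι)Φ♯)(z_ι + e_κ) − (Q′_j(Û_ι)Φ♯)(z_ι)`; `Q′_j(Û_ι)Φ♯` at the two end labels reads `Û_ι = U♯` on their blocks
(`QprimeIter_bgT_congr_bg`), and `(Q′_j(U♯)Φ♯)` vanishes there when `Q′(U; parKnitY)Φ = 0` on `𝔅` (file 2, no regime needed).  (iii) Assemble with (i).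

WHAT IS PROVED (sorry-free; no new definition; no estimate of the papers beyond the landed ones).
* §1 `liftCfg_eq_readY` (J-A's lift IS g34's reading), `proj_eq_transl_zero`, `blk_eq_of_inBox_block`, `inBox_block_of_blk_eq`.
* §2 `compT_bgT_congr` (the composite knit transporter to `x` from its level-`j` ancestor reads `U₀` on the `Lʲ`-block only).
* §3 ★ `norm_hol_liftCfg_plaqWord_sub_one_le_block` ((3.35) ⇒ every plaquette of `U♯` based in the block box of `s ∈ 𝔅` is within `K_pl·L⁴·(L^{j_s})⁻²` of `1`),
  `pdev_retract_block_lt`, ★★ `knitT_mem_unitary_of_reg335P`, ★★ `parKnitY_mem_unitary_of_reg335P` (the knit letter is `U(N)`-valued on (3.35)).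
* §4 `pdev_retract_bond_lt` (g34's double-block bound, lift currency), ★★ `QknitY_gradY_apply_retract` ((3.115) at `ι` through the retraction, on (3.35)),
  ★★ `QknitY_gradY_eq_zero_of_QpY_eq_zero_of_reg335P`.
* §5 ★★★ `QknitY_gradY_GpY_RY_parKnitY_of_reg335P`, ★★★ `QknitY_gradY_GpPhysY_RY_parKnitY_of_reg335P` — **`hZ` AT THE KNIT PAIR ON THE CLASS (3.35)** with the x-free
  numerics `K_pl(Mα₀)·L⁴ < α₀′`, `C₀α₀′ ≤ 1/3`, `2α₀′ ≤ c₂′` (g34's `hwKa` threshold shape), `c₀ ≤ 10`, `0 ≤ Mα₀`, `G ≤ U(N)` with `|u| ≤ 1` on `G`.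

HONEST SCOPE.  Locality bookkeeping + the landed levelled plaquette reading of (3.35); the only inequalities used are those already in the tree.  This theorem has the
certificate's binder SHAPE at the pair (`QknitY`, `parKnitY`); it does NOT discharge the certificate's displayed `hZ` (stated at `QY parBY ∕ parSymY`) — that needs the
re-pin (def-Y's desk, n06-d's edition, the director's word).  Count-neutral; N06 NOT discharged; nothing continuum ∕ ℝ⁴ ∕ OS ∕ mass gap ∕ Clay — the Yang–Mills mass gap is
NOT proved here.  NEW file; nothing landed is modified.  No `sorry`, no `axiom`, no `instance`, no `notation`.  Net new unproved facts: 0.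
-/

noncomputable section

open scoped BigOperators

namespace Literature.MathematicalPhysics.QuantumFieldTheory.Balaban1983to89.B9Eq3124HZKnitPairReg335Y

open B7Prop1Explicit renaming Site → LSite
open B7Prop1Explicit (e e_apply hol plaqWord U1 Wcx boxVec)
open B7Prop1Local (InBox AgreeOn loK bondHiK add_e_apply)
open B7Prop5Flat (BondIn)
open Literature.MathematicalPhysics.QuantumLattice (blockSites blockBase blockMap mem_blockSites_iff)
open B7Eq78Linearization (conjR conjR_apply QprimeIter zdBlocking)
open B7Prop2Explicit (avgIter avgIter_mem AvgClosed pdev hol_plaqWord_self hol_mem_of C0 c2' unitaryUnits unitaryUnits_le_U1 avgClosed_unitaryUnits)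
open B7AvgGaugeCovariance (Wcx_avgIter_lt_one)
open B7Prop4LinCovIterClosed (linCovIterC linCovIterC_smul eq3115C)
open B7Prop4LinCovIterClosedLaws (linCovIterC_congr)
open B7Eq52RetractionExtension (retrCfg retrCfg_eq_of_bondIn retrCfg_mem pdev_retrCfg_lt)
open B7AvgPeriodicity (proj)
open B8Ineq132 (covDerivFwd)
open B8Eq119TwistedAxial (bgT)
open B8Ineq159CurvedCubeMemberLocalTower (bgT_congr_bg)
open B9Eq326DeltaALocalityZd (QprimeIter_bgT_congr_bg)
open B10Eq27TorusAxialLog (transl transl_apply)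
open B4Reflection242 (boxDom mem_boxDom blk)
open B5Eq118OneStroke (iterBlockOf)
open B6MultiLevelBoxOperator (N0)
open B6Geom246MultiLevelBox (bset blkOf blkOf_val blkOf_eq_iff_blk lev_eq_of_blkOf_eq scale_bounds)
open B6GlobalChartV1 (PV boxEquiv boxEquiv_apply toBox)
open B6KLevelCensusIndexV1 (KIdx kGeo)
open B6Prop22KLevelTorusCensus (KTIdx)
open B6Ineq2142KLevelV1 (lvl lev_ends_bounds)
open B9B8CarrierDictionary (liftFun liftCfg liftCfg_apply liftCfg_mem)
open B9B8KnitBondTransfer (liftBd liftBd_apply)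
open B9B8KnitLetterTransfer (liftL liftL_eq)
open B9B8AveragingKernelZd (compT compT_zero compT_succ)
open B9B8AveragingJunction (knitT parOfT parKnitY blockMap_iterate blk_eq_blockMap mem_XB_of_blk_eq boxEquiv_transl_of_mem coord_bounds_of_blk_eq)
open B9B8KnitLetterProjectionC (QpY_GpY_RY_parKnitY)
open B9B8KnitLetterRegular (hol_liftCfg_plaqWord hol_plaqWord_swap compT_mem)
open B9Eq3115KnitLetterY (zSrc zSrc_eq_rep QknitY QknitY_apply liftBd_gradY lvl_le' one_le_lvl' QprimeIter_liftL_zSrc_eq_zero QprimeIter_liftL_zSrc_add_e_eq_zero)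
open B9C2LettersTorusY (T0 readY readY_apply zOf κOf)
open B9C2FormBoxRegimeY (Kpl Kpl_nonneg scale_slack lo_le_hi_box ends_of_inBox norm_hol_readY_plaqWord_sub_one_le_of_reg335P)
open B9BackgroundsKLevelV1 (levV1)
open B9BackgroundsKLevelV1P (bg9KP mem_of_reg335P)
open B9Eq335CoveragePAtLettersY (norm_holY_sub_one_le_levelled_of_reg335P)
open B9GeoLemma21KLevelV1 (one_le_k)
open B9Eq3132Ineq2142Covariant (two_le_RMh)
open Node00

variable {d ℓ : ℕ} {hd : 1 ≤ d + 1} {hL : Odd (ℓ + 1) ∧ 1 < ℓ + 1} {b₀ b₁ : ℝ}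

/-! ## §1 Dictionary and box bookkeeping -/

section Dictionary

variable {𝔸 : Type} [NormedRing 𝔸] [NormedAlgebra ℂ 𝔸] [CompleteSpace 𝔸]
variable (i : KIdx d ℓ hd hL b₀ b₁)

omit [NormedRing 𝔸] [NormedAlgebra ℂ 𝔸] [CompleteSpace 𝔸] in
/-- `proj (T0 i) y = 0 + y`: g34's torus chart point IS J-A's translate of the origin. [cite: Balaban1987RG1, (0.1) p.251, dictionary] -/
theorem proj_eq_transl_zero (y : LSite (d + 1)) : proj (T0 i) y = transl (0 : Site (PV d ℓ i.m i.K hd hL) 0) y := by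
  funext ν
  rw [transl_apply, show (0 : Site (PV d ℓ i.m i.K hd hL) 0) ν = 0 from rfl, zero_add]
  rfl

/-- ★ **J-A's periodic lift IS g34's `ℤ^{d+1}`-reading**: `liftCfg U = readY i U`. [cite: Balaban1985RegularSpaces, p.77 («Ω_j = T_η»); Balaban1987RG1, (0.1) p.251, dictionary] -/
theorem liftCfg_eq_readY (U : CfgY 𝔸 i) : liftCfg U = readY i U := by
  funext z μ
  rw [liftCfg_apply, readY_apply, proj_eq_transl_zero]

omit [NormedRing 𝔸] [NormedAlgebra ℂ 𝔸] [CompleteSpace 𝔸] in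
/-- a point of the block box `[Lʲy, Lʲy + (Lʲ − 1)𝟙]` has `Lʲ`-label `y`. [cite: Balaban1984PropagatorsII, (2.1) p.224, dictionary] -/
theorem blk_eq_of_inBox_block {j : ℕ} {y x : LSite (d + 1)}
    (hx : InBox (blockBase ((ℓ + 1) ^ j) y) (blockBase ((ℓ + 1) ^ j) y + ((((ℓ + 1 : ℕ) : ℤ) ^ j) - 1) • (1 : LSite (d + 1))) x) :
    blk ((ℓ + 1) ^ j) x = y := by
  have hbz : (0 : ℤ) < (((ℓ + 1) ^ j : ℕ) : ℤ) := by positivity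
  funext μ
  obtain ⟨h1, h2⟩ := hx μ
  simp only [blockBase, Pi.add_apply, Pi.smul_apply, Pi.one_apply, smul_eq_mul, mul_one, ← Nat.cast_pow] at h1 h2
  show x μ / (((ℓ + 1) ^ j : ℕ) : ℤ) = y μ
  apply le_antisymm
  · have h : x μ < (y μ + 1) * (((ℓ + 1) ^ j : ℕ) : ℤ) := by linarith
    have := Int.ediv_lt_of_lt_mul hbz h
    omega
  · exact Int.le_ediv_of_mul_le hbz (by linarith)

omit [NormedRing 𝔸] [NormedAlgebra ℂ 𝔸] [CompleteSpace 𝔸] in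
/-- conversely a point with `Lʲ`-label `y` lies in the block box. [cite: Balaban1984PropagatorsII, (2.1) p.224, dictionary] -/
theorem inBox_block_of_blk_eq {j : ℕ} {y x : LSite (d + 1)} (hx : blk ((ℓ + 1) ^ j) x = y) :
    InBox (blockBase ((ℓ + 1) ^ j) y) (blockBase ((ℓ + 1) ^ j) y + ((((ℓ + 1 : ℕ) : ℤ) ^ j) - 1) • (1 : LSite (d + 1))) x := by
  have hb1 : 1 ≤ (ℓ + 1) ^ j := Nat.one_le_pow _ _ (Nat.succ_pos ℓ)
  intro μ
  obtain ⟨hlo, hhi⟩ := coord_bounds_of_blk_eq hb1 hx μ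
  simp only [blockBase, Pi.add_apply, Pi.smul_apply, Pi.one_apply, smul_eq_mul, mul_one, ← Nat.cast_pow]
  constructor <;> linarith

omit [NormedRing 𝔸] [NormedAlgebra ℂ 𝔸] [CompleteSpace 𝔸] in
/-- the block box of a LABEL is non-degenerate (`Lʲ ≥ 1`). [cite: Balaban1984PropagatorsII, (2.1) p.224, bookkeeping] -/
theorem blockBox_lo_le_hi (j : ℕ) (y : LSite (d + 1)) (μ : Fin (d + 1)) :
    blockBase ((ℓ + 1) ^ j) y μ ≤ (blockBase ((ℓ + 1) ^ j) y + ((((ℓ + 1 : ℕ) : ℤ) ^ j) - 1) • (1 : LSite (d + 1))) μ := by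
  have hb1 : (1 : ℤ) ≤ (((ℓ + 1 : ℕ) : ℤ)) ^ j := one_le_pow₀ (by exact_mod_cast Nat.succ_pos ℓ)
  simp only [Pi.add_apply, Pi.smul_apply, Pi.one_apply, smul_eq_mul, mul_one]
  linarith

end Dictionary

/-! ## §2 Locality of the knit's composite transporter; bondwise agreement of covariant derivatives -/

section Locality

variable {𝔸 : Type} [NormedRing 𝔸] [NormedAlgebra ℂ 𝔸] [CompleteSpace 𝔸]

omit [NormedAlgebra ℂ 𝔸] [CompleteSpace 𝔸] in
/-- [folklore] a site with `L`-label `y`: `L·y ≤ x ≤ L·y + (L − 1)`. -/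
private theorem bounds_of_blockMap_eq {L : ℕ} (hL : 1 ≤ L) {y x : LSite (d + 1)} (h : blockMap L x = y) (μ : Fin (d + 1)) :
    (L : ℤ) * y μ ≤ x μ ∧ x μ ≤ (L : ℤ) * y μ + ((L : ℤ) - 1) := by
  rw [← blk_eq_blockMap] at h
  obtain ⟨h1, h2⟩ := coord_bounds_of_blk_eq hL h μ
  exact ⟨h1, by linarith⟩

/-- ★ **THE KNIT's COMPOSITE TRANSPORTER `U(Γ^{(j)}_{y,x})`, `y = y_j(x)`, READS THE BACKGROUND ON THE `Lʲ`-BLOCK OF `y` ONLY** — each leg `Ūⁱ(Γ_{Ly′,x′})`,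
`i < j`, is a block transporter of an averaged background inside that block ([5] p. 24 locality of the averages, `bgT_congr_bg`); J-B's `compT` by induction.
[cite: Balaban1985BackgroundPropagators, (3.19) p.393; Balaban1985Averaging, p.24 (after (43)), (52)–(53) p.27] -/
theorem compT_bgT_congr {L : ℕ} (hL : 1 ≤ L) {V V' : LSite (d + 1) → Fin (d + 1) → 𝔸ˣ} :
    ∀ (j : ℕ) (x : LSite (d + 1)),
      AgreeOn (blockBase (L ^ j) ((blockMap L)^[j] x)) (blockBase (L ^ j) ((blockMap L)^[j] x) + (((L : ℤ) ^ j) - 1) • (1 : LSite (d + 1))) V V' →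
        compT L (bgT L V) j ((blockMap L)^[j] x) x = compT L (bgT L V') j ((blockMap L)^[j] x) x
  | 0, _, _ => by rw [compT_zero, compT_zero]
  | j + 1, x, h => by
    rw [compT_succ, compT_succ]
    have hy : (blockMap L)^[j + 1] x = blockMap L ((blockMap L)^[j] x) := Function.iterate_succ_apply' _ _ _
    rw [hy] at h ⊢
    -- the top leg reads the `L^{j+1}`-block of `y`
    have h1 : bgT L V j (blockMap L ((blockMap L)^[j] x)) ((blockMap L)^[j] x) = bgT L V' j (blockMap L ((blockMap L)^[j] x)) ((blockMap L)^[j] x) :=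
      bgT_congr_bg hL j _ h
    -- the lower composite reads the `Lʲ`-block of `x_j`, inside the `L^{j+1}`-block of `y`
    have hLj : (0 : ℤ) ≤ (L : ℤ) ^ j := by positivity
    have hb := bounds_of_blockMap_eq hL (rfl : blockMap L ((blockMap L)^[j] x) = _)
    have h2 : compT L (bgT L V) j ((blockMap L)^[j] x) x = compT L (bgT L V') j ((blockMap L)^[j] x) x := by
      refine compT_bgT_congr hL j x (h.mono (fun μ => ?_) (fun μ => ?_))
      · have h1' := mul_le_mul_of_nonneg_left (hb μ).1 hLj
        simp only [blockBase]
        push_cast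
        rw [pow_succ]
        nlinarith
      · have h2' := mul_le_mul_of_nonneg_left (hb μ).2 hLj
        simp only [blockBase, Pi.add_apply, Pi.smul_apply, Pi.one_apply, smul_eq_mul, mul_one]
        push_cast
        rw [pow_succ]
        nlinarith
    rw [h1, h2]

omit [CompleteSpace 𝔸] in
/-- [folklore] the forward covariant difference at the bond `(x, μ)` reads the configuration at that bond only. -/
private theorem covDerivFwd_congr_bond {V V' : LSite (d + 1) → Fin (d + 1) → 𝔸ˣ} {x : LSite (d + 1)} {μ : Fin (d + 1)} (h : V x μ = V' x μ)
    (f : LSite (d + 1) → 𝔸) : covDerivFwd 1 V μ f x = covDerivFwd 1 V' μ f x := by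
  simp [covDerivFwd, h]

end Locality

/-! ## §3 The knit letter is `U(N)`-valued on print's class (3.35) -/

section Legs

open scoped Matrix Matrix.Norms.L2Operator

variable {N : ℕ} [Nonempty (Fin N)] (i : KIdx d ℓ hd hL b₀ b₁) {G : Subgroup (Matrix (Fin N) (Fin N) ℂ)ˣ}

/-- ★ **ON (3.35) EVERY PLAQUETTE OF `U♯` BASED IN THE BOX OF A BLOCK `s = (j, y) ∈ 𝔅` IS WITHIN `K_pl·L⁴·(Lʲ)⁻²` OF `1`**: the base is a fine site of the block,
of level exactly `j`, so n06-j's levelled reading of (3.35) gives `K_pl·(L^{j−1})⁻²` (`norm_holY_sub_one_le_levelled_of_reg335P` through J-B's plaquette dictionary;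
the reversed orientation by the inverse, unit-bounded `G`). [cite: Balaban1985BackgroundPropagators, (3.35) p.396, (3.69) p.404; Balaban1985Averaging, (52) p.26] -/
theorem norm_hol_liftCfg_plaqWord_sub_one_le_block (hG1 : ∀ u : (Matrix (Fin N) (Fin N) ℂ)ˣ, u ∈ G → ‖(u : Matrix (Fin N) (Fin N) ℂ)‖ ≤ 1)
    (U : CfgY (Matrix (Fin N) (Fin N) ℂ) i) {c₀ α₀ : ℝ} (hc : c₀ ≤ 10) (hMα : 0 ≤ (kGeo i).M * α₀)
    (hreg : (bg9KP (Matrix (Fin N) (Fin N) ℂ) G i).Reg335 c₀ α₀ U) (s : BlkY i) {y : LSite (d + 1)}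
    (hy : InBox (blockBase ((ℓ + 1) ^ s.1.1) s.1.2) (blockBase ((ℓ + 1) ^ s.1.1) s.1.2 + ((((ℓ + 1 : ℕ) : ℤ) ^ s.1.1) - 1) • (1 : LSite (d + 1))) y)
    (μ ν : Fin (d + 1)) :
    ‖((hol (liftCfg U) y (plaqWord μ ν) : (Matrix (Fin N) (Fin N) ℂ)ˣ) : Matrix (Fin N) (Fin N) ℂ) - 1‖ ≤
      Kpl i ((kGeo i).M * α₀) * ((kGeo i).L ^ 4 * ((((kGeo i).L ^ s.1.1)⁻¹) ^ 2)) := by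
  have hK0 : 0 ≤ Kpl i ((kGeo i).M * α₀) := Kpl_nonneg i hMα
  have hL0 : (0 : ℝ) ≤ (kGeo i).L := by rw [show (kGeo i).L = ((ℓ + 1 : ℕ) : ℝ) from rfl]; positivity
  have hR0 : 0 ≤ Kpl i ((kGeo i).M * α₀) * ((kGeo i).L ^ 4 * ((((kGeo i).L ^ s.1.1)⁻¹) ^ 2)) := by positivity
  -- the base is a box point of the block `s`, of level `j_s`
  have hblk : blk ((ℓ + 1) ^ s.1.1) y = s.1.2 := blk_eq_of_inBox_block hy
  have hyXB : y ∈ (toKT i).XB := mem_XB_of_blk_eq i s hblk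
  have hlev : levV1 i (transl (0 : Site (PV d ℓ i.m i.K hd hL) 0) y) = s.1.1 := by
    have hbox : toBox i.hN (transl (0 : Site (PV d ℓ i.m i.K hd hL) 0) y) = ⟨y, hyXB⟩ := by
      rw [← boxEquiv_apply]; exact boxEquiv_transl_of_mem i hyXB
    show i.D.lev (toBox i.hN (transl (0 : Site (PV d ℓ i.m i.K hd hL) 0) y)).1 = s.1.1
    rw [hbox]
    exact lev_eq_of_blkOf_eq i.D.toDomains ((blkOf_eq_iff_blk i.D.toDomains).2 hblk)
  have hslack := scale_slack i (n := s.1.1) (j := s.1.1) (by omega)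
  -- the levelled reading at an oriented plaquette based at `0 + y`
  have key : ∀ {μ' ν' : Fin (d + 1)} (h : μ' < ν'),
      ‖((Node00.holY i U ⟨transl 0 y, μ', ν', h⟩ : (Matrix (Fin N) (Fin N) ℂ)ˣ) : Matrix (Fin N) (Fin N) ℂ) - 1‖ ≤
        Kpl i ((kGeo i).M * α₀) * ((kGeo i).L ^ 4 * ((((kGeo i).L ^ s.1.1)⁻¹) ^ 2)) := fun h => by
    have h1 := norm_holY_sub_one_le_levelled_of_reg335P i U hc hMα hreg ⟨transl 0 y, _, _, h⟩
    have h2 : (((kGeo i).L ^ (levV1 i (transl (0 : Site (PV d ℓ i.m i.K hd hL) 0) y) - 1))⁻¹) ^ 2 ≤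
        (kGeo i).L ^ 4 * ((((kGeo i).L ^ s.1.1)⁻¹) ^ 2) := by rw [hlev]; exact hslack
    exact h1.trans (mul_le_mul_of_nonneg_left h2 hK0)
  rcases lt_trichotomy μ ν with hlt | heq | hgt
  · rw [hol_liftCfg_plaqWord i U y hlt]; exact key hlt
  · subst heq; rw [hol_plaqWord_self]; simpa using hR0
  · rw [hol_plaqWord_swap, hol_liftCfg_plaqWord i U y hgt]
    have hmem : Node00.holY i U ⟨transl 0 y, ν, μ, hgt⟩ ∈ G := by
      unfold Node00.holY
      have hU := mem_of_reg335P (𝔸 := Matrix (Fin N) (Fin N) ℂ) (G := G) i hreg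
      exact G.mul_mem (G.mul_mem (G.mul_mem (hU _ _) (hU _ _)) (G.inv_mem (hU _ _))) (G.inv_mem (hU _ _))
    have hU1 : Node00.holY i U ⟨transl 0 y, ν, μ, hgt⟩ ∈ U1 (Matrix (Fin N) (Fin N) ℂ) :=
      ⟨hG1 _ hmem, hG1 _ (G.inv_mem hmem)⟩
    exact (B7Prop1Explicit.norm_inv_sub_one_le hU1).trans (key hgt)

/-- ★ **THE RETRACTION OF `U♯` TO THE BOX OF A BLOCK SATISFIES [5]'s GLOBAL (52) AT THE BLOCK's SCALE**: `pdev Û_s < α₀′·(L^{j_s})⁻²` whenever `K_pl·L⁴ < α₀′`.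
[cite: Balaban1985Averaging, (52) p.26, Prop. 2 p.26 (locality sentence); Balaban1985BackgroundPropagators, (3.35) p.396] -/
theorem pdev_retract_block_lt (hG1 : ∀ u : (Matrix (Fin N) (Fin N) ℂ)ˣ, u ∈ G → ‖(u : Matrix (Fin N) (Fin N) ℂ)‖ ≤ 1)
    (U : CfgY (Matrix (Fin N) (Fin N) ℂ) i) {c₀ α₀ : ℝ} (hc : c₀ ≤ 10) (hMα : 0 ≤ (kGeo i).M * α₀)
    (hreg : (bg9KP (Matrix (Fin N) (Fin N) ℂ) G i).Reg335 c₀ α₀ U) {α₀' : ℝ} (hK : Kpl i ((kGeo i).M * α₀) * (kGeo i).L ^ 4 < α₀') (s : BlkY i) :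
    pdev (retrCfg (blockBase ((ℓ + 1) ^ s.1.1) s.1.2) (blockBase ((ℓ + 1) ^ s.1.1) s.1.2 + ((((ℓ + 1 : ℕ) : ℤ) ^ s.1.1) - 1) • (1 : LSite (d + 1)))
        (liftCfg U)) < α₀' * ((((ℓ + 1 : ℕ) : ℝ) ^ s.1.1)⁻¹) ^ 2 := by
  have hK0 : 0 ≤ Kpl i ((kGeo i).M * α₀) := Kpl_nonneg i hMα
  have hL : (kGeo i).L = ((ℓ + 1 : ℕ) : ℝ) := rfl
  have hLpos : (0 : ℝ) < ((ℓ + 1 : ℕ) : ℝ) ^ s.1.1 := by positivity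
  have hpos : (0 : ℝ) < ((((ℓ + 1 : ℕ) : ℝ) ^ s.1.1)⁻¹) ^ 2 := by positivity
  refine pdev_retrCfg_lt (blockBox_lo_le_hi (d := d) (ℓ := ℓ) s.1.1 s.1.2) (liftCfg U) (M := Kpl i ((kGeo i).M * α₀) * ((kGeo i).L ^ 4 * ((((kGeo i).L ^ s.1.1)⁻¹) ^ 2)))
    (by rw [hL]; positivity) ?_ (fun y μ ν _ hy _ _ => norm_hol_liftCfg_plaqWord_sub_one_le_block i hG1 U hc hMα hreg s hy μ ν)
  rw [hL, ← mul_assoc]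
  exact mul_lt_mul_of_pos_right hK hpos

/-- ★★ **ON (3.35) THE KNIT TRANSPORTER TO EVERY SITE IS `U(N)`-VALUED**: `U(Γ^{(j)}_{y,w}) ∈ U(N)` for every box site `w` (block `s = (j, y)`), for a `G`-valued
background (`G ≤ U(N)`, `|u| ≤ 1` on `G`) in the class with `K_pl·L⁴ < α₀′` and [5] Prop. 2's smallness of `α₀′`: the leg reads `U♯` on the block only
(`compT_bgT_congr`), where it may be replaced by the retraction, whose averages `Ūⁱ`, `i ≤ j`, are `U(N)`-valued (`avgIter_mem`, `U(N)` averaging-closed).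
[cite: Balaban1985BackgroundPropagators, (3.19) p.393, (3.35) p.396; Balaban1985Averaging, Prop. 2 (52)–(54) p.26, p.24] -/
theorem knitT_mem_unitary_of_reg335P (hG1 : ∀ u : (Matrix (Fin N) (Fin N) ℂ)ˣ, u ∈ G → ‖(u : Matrix (Fin N) (Fin N) ℂ)‖ ≤ 1)
    (hGU : G ≤ unitaryUnits (Matrix (Fin N) (Fin N) ℂ))
    (U : CfgY (Matrix (Fin N) (Fin N) ℂ) i) {c₀ α₀ : ℝ} (hc : c₀ ≤ 10) (hMα : 0 ≤ (kGeo i).M * α₀)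
    (hreg : (bg9KP (Matrix (Fin N) (Fin N) ℂ) G i).Reg335 c₀ α₀ U) {α₀' : ℝ} (hα' : 0 < α₀') (hα3 : C0 (d + 1) * α₀' ≤ 1 / 3)
    (hα2 : 2 * α₀' ≤ c2' (d + 1) (ℓ + 1)) (hK : Kpl i ((kGeo i).M * α₀) * (kGeo i).L ^ 4 < α₀') (w : SiteY i) :
    knitT i (bgT (ℓ + 1) (liftCfg U)) w ∈ unitaryUnits (Matrix (Fin N) (Fin N) ℂ) := by
  letI : CStarAlgebra (Matrix (Fin N) (Fin N) ℂ) := {}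
  have hL1 : 1 ≤ ℓ + 1 := Nat.succ_pos ℓ
  have hL2 : 2 ≤ ℓ + 1 := hL.2
  set s : BlkY i := blkOf i.D.toDomains w with hs
  set j : ℕ := s.1.1 with hj
  have hjw : levY i w = j := rfl
  have hyw : blk ((ℓ + 1) ^ j) w.1 = s.1.2 := rfl
  have hit : (blockMap (ℓ + 1))^[j] w.1 = s.1.2 := by rw [blockMap_iterate, ← blk_eq_blockMap]; exact hyw
  -- the retraction of `U♯` to the block box of `s`
  set lo : LSite (d + 1) := blockBase ((ℓ + 1) ^ j) s.1.2 with hlo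
  set hi : LSite (d + 1) := blockBase ((ℓ + 1) ^ j) s.1.2 + ((((ℓ + 1 : ℕ) : ℤ) ^ j) - 1) • (1 : LSite (d + 1)) with hhi
  set V : LSite (d + 1) → Fin (d + 1) → (Matrix (Fin N) (Fin N) ℂ)ˣ := retrCfg lo hi (liftCfg U) with hV
  have hagree : AgreeOn lo hi (liftCfg U) V := fun x μ hx hxe => (retrCfg_eq_of_bondIn (liftCfg U) ⟨hx, hxe⟩).symm
  have hU : ∀ μ x, U μ x ∈ unitaryUnits (Matrix (Fin N) (Fin N) ℂ) := fun μ x => hGU (mem_of_reg335P (G := G) i hreg μ x)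
  have hVu : ∀ x μ, V x μ ∈ unitaryUnits (Matrix (Fin N) (Fin N) ℂ) := fun x μ => retrCfg_mem (fun x μ => liftCfg_mem hU x μ) x μ
  have h52 : pdev V < α₀' * ((((ℓ + 1 : ℕ) : ℝ) ^ j)⁻¹) ^ 2 := pdev_retract_block_lt i hG1 U hc hMα hreg hK s
  have havg := avgIter_mem (ℓ + 1) hL2 (avgClosed_unitaryUnits (d + 1) (ℓ + 1)) j V hVu hα' hα3 hα2 h52
  -- the leg reads `U♯` on the block only: replace by the retraction, then every averaged leg is unitary
  have hknit : knitT i (bgT (ℓ + 1) (liftCfg U)) w = compT (ℓ + 1) (bgT (ℓ + 1) V) j s.1.2 w.1 := by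
    show compT (ℓ + 1) (bgT (ℓ + 1) (liftCfg U)) (levY i w) (blk ((ℓ + 1) ^ levY i w) w.1) w.1 = _
    rw [hjw, hyw, ← hit]
    exact compT_bgT_congr hL1 j w.1 (by rw [hit]; exact hagree)
  rw [hknit]
  exact compT_mem (ℓ + 1) j (fun j' hj' y x => hol_mem_of (havg j' hj'.le) _ _) _ _

/-- ★★ **ON (3.35) THE KNIT SITE TRANSPORTER `parKnitY U` IS `U(N)`-VALUED** (every pair of sites: a leg, an inverse leg, or `1`).
[cite: Balaban1985BackgroundPropagators, (3.19) p.393, (3.24)–(3.25) pp.394–395, (3.35) p.396] -/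
theorem parKnitY_mem_unitary_of_reg335P (hG1 : ∀ u : (Matrix (Fin N) (Fin N) ℂ)ˣ, u ∈ G → ‖(u : Matrix (Fin N) (Fin N) ℂ)‖ ≤ 1)
    (hGU : G ≤ unitaryUnits (Matrix (Fin N) (Fin N) ℂ))
    (U : CfgY (Matrix (Fin N) (Fin N) ℂ) i) {c₀ α₀ : ℝ} (hc : c₀ ≤ 10) (hMα : 0 ≤ (kGeo i).M * α₀)
    (hreg : (bg9KP (Matrix (Fin N) (Fin N) ℂ) G i).Reg335 c₀ α₀ U) {α₀' : ℝ} (hα' : 0 < α₀') (hα3 : C0 (d + 1) * α₀' ≤ 1 / 3)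
    (hα2 : 2 * α₀' ≤ c2' (d + 1) (ℓ + 1)) (hK : Kpl i ((kGeo i).M * α₀) * (kGeo i).L ^ 4 < α₀') (z w : SiteY i) :
    parKnitY i U z w ∈ unitaryUnits (Matrix (Fin N) (Fin N) ℂ) := by
  have hk := fun w => knitT_mem_unitary_of_reg335P i hG1 hGU U hc hMα hreg hα' hα3 hα2 hK w
  show parOfT i (bgT (ℓ + 1) (liftCfg U)) z w ∈ _
  unfold parOfT
  split_ifs
  · exact hk w
  · exact (unitaryUnits _).inv_mem (hk z)
  · exact (unitaryUnits _).one_mem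

end Legs

/-! ## §4 (3.115) at an index bond through the retraction to its double block -/

section Bond

open scoped Matrix Matrix.Norms.L2Operator

variable {N : ℕ} [Nonempty (Fin N)] (i : KIdx d ℓ hd hL b₀ b₁) {G : Subgroup (Matrix (Fin N) (Fin N) ℂ)ˣ}

/-- ★ **THE RETRACTION OF `U♯` TO THE DOUBLE BLOCK OF AN INDEX BOND SATISFIES [5]'s GLOBAL (52) AT THE BOND's SCALE** (g34's `pdev_retract_readY_le_of_reg335P`
in the lift currency, strict): `pdev Û_ι < α₀′·(L^{j(ι)})⁻²` whenever `K_pl·L⁴ < α₀′`. [cite: Balaban1985Averaging, (52) p.26, Prop. 2 p.26 (locality sentence); Balaban1985BackgroundPropagators, (3.35) p.396] -/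
theorem pdev_retract_bond_lt (hG1 : ∀ u : (Matrix (Fin N) (Fin N) ℂ)ˣ, u ∈ G → ‖(u : Matrix (Fin N) (Fin N) ℂ)‖ ≤ 1)
    (U : CfgY (Matrix (Fin N) (Fin N) ℂ) i) {c₀ α₀ : ℝ} (hc : c₀ ≤ 10) (hMα : 0 ≤ (kGeo i).M * α₀)
    (hreg : (bg9KP (Matrix (Fin N) (Fin N) ℂ) G i).Reg335 c₀ α₀ U) {α₀' : ℝ} (hK : Kpl i ((kGeo i).M * α₀) * (kGeo i).L ^ 4 < α₀') (ι : IBondY i) :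
    pdev (retrCfg (loK (ℓ + 1) (ι.1.1 : ℕ) (zSrc i ι)) (bondHiK (ℓ + 1) (ι.1.1 : ℕ) (zSrc i ι) ι.1.2.dir) (liftCfg U))
      < α₀' * ((((ℓ + 1 : ℕ) : ℝ) ^ (ι.1.1 : ℕ))⁻¹) ^ 2 := by
  have hK0 : 0 ≤ Kpl i ((kGeo i).M * α₀) := Kpl_nonneg i hMα
  have hL : (kGeo i).L = ((ℓ + 1 : ℕ) : ℝ) := rfl
  have hpos : (0 : ℝ) < ((((ℓ + 1 : ℕ) : ℝ) ^ (ι.1.1 : ℕ))⁻¹) ^ 2 := by positivity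
  refine pdev_retrCfg_lt (lo_le_hi_box i ι) (liftCfg U) (M := Kpl i ((kGeo i).M * α₀) * ((kGeo i).L ^ 4 * ((((kGeo i).L ^ (ι.1.1 : ℕ))⁻¹) ^ 2)))
    (by rw [hL]; positivity) ?_ (fun y μ ν _ hy _ _ => ?_)
  · rw [hL, ← mul_assoc]
    exact mul_lt_mul_of_pos_right hK hpos
  · rw [liftCfg_eq_readY]
    exact norm_hol_readY_plaqWord_sub_one_le_of_reg335P i hG1 U hc hMα hreg ι hy μ ν

/-- ★★ **(3.115) AT AN INDEX BOND THROUGH THE RETRACTION, ON (3.35)**: for every box function `Φ`,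
`(Q(U)(D_UΦ))(ι) = L^{−j}c_f·(R(\overline{Û_ι}ʲ(z_ι, κ))(Q′_j(U♯)Φ♯)(z_ι + e_κ) − (Q′_j(U♯)Φ♯)(z_ι))` — file 2's `QknitY_gradY_apply` with `U♯` replaced by the
retraction `Û_ι` inside `Q_j` and `Ūʲ` (locality, file 3), (3.115) run for `Û_ι` (its loop conditions from `pdev Û_ι < α₀′(Lʲ)⁻²`), and `Q′_j(Û_ι)Φ♯` at the two
end labels read back on `U♯` (`QprimeIter_bgT_congr_bg`). [cite: Balaban1985BackgroundPropagators, (3.115) p.418, (3.35) p.396; Balaban1985Averaging, Prop. 2 p.26, p.24] -/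
theorem QknitY_gradY_apply_retract (hG1 : ∀ u : (Matrix (Fin N) (Fin N) ℂ)ˣ, u ∈ G → ‖(u : Matrix (Fin N) (Fin N) ℂ)‖ ≤ 1)
    (hGU : G ≤ unitaryUnits (Matrix (Fin N) (Fin N) ℂ))
    (U : CfgY (Matrix (Fin N) (Fin N) ℂ) i) {c₀ α₀ : ℝ} (hc : c₀ ≤ 10) (hMα : 0 ≤ (kGeo i).M * α₀)
    (hreg : (bg9KP (Matrix (Fin N) (Fin N) ℂ) G i).Reg335 c₀ α₀ U) {α₀' : ℝ} (hα' : 0 < α₀') (hα3 : C0 (d + 1) * α₀' ≤ 1 / 3)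
    (hα2 : 2 * α₀' ≤ c2' (d + 1) (ℓ + 1)) (hK : Kpl i ((kGeo i).M * α₀) * (kGeo i).L ^ 4 < α₀') (Φ : SiteY i → Matrix (Fin N) (Fin N) ℂ)
    (ι : IBondY i) :
    QknitY i U (gradY i U Φ) ι
      = (((((ℓ + 1 : ℕ) : ℝ) ^ (ι.1.1 : ℕ))⁻¹ * i.cf : ℝ) : ℂ) •
        (conjR (avgIter (ℓ + 1) (retrCfg (loK (ℓ + 1) (ι.1.1 : ℕ) (zSrc i ι)) (bondHiK (ℓ + 1) (ι.1.1 : ℕ) (zSrc i ι) ι.1.2.dir) (liftCfg U))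
              (ι.1.1 : ℕ) (zSrc i ι) ι.1.2.dir)
            (QprimeIter (zdBlocking (d + 1) (ℓ + 1)) (bgT (ℓ + 1) (liftCfg U)) (ι.1.1 : ℕ) (liftL i Φ) (zSrc i ι + e ι.1.2.dir))
          - QprimeIter (zdBlocking (d + 1) (ℓ + 1)) (bgT (ℓ + 1) (liftCfg U)) (ι.1.1 : ℕ) (liftL i Φ) (zSrc i ι)) := by
  letI : CStarAlgebra (Matrix (Fin N) (Fin N) ℂ) := {}
  have hL1 : 1 ≤ ℓ + 1 := Nat.succ_pos ℓ
  have hL2 : 2 ≤ ℓ + 1 := hL.2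
  set j : ℕ := (ι.1.1 : ℕ) with hj
  set z := zSrc i ι with hz
  set κ := ι.1.2.dir with hκ
  set lo := loK (ℓ + 1) j z with hlo
  set hi := bondHiK (ℓ + 1) j z κ with hhi
  set V : LSite (d + 1) → Fin (d + 1) → (Matrix (Fin N) (Fin N) ℂ)ˣ := retrCfg lo hi (liftCfg U) with hV
  have hagree : AgreeOn lo hi (liftCfg U) V := fun x μ hx hxe => (retrCfg_eq_of_bondIn (liftCfg U) ⟨hx, hxe⟩).symm
  have hU : ∀ μ x, U μ x ∈ unitaryUnits (Matrix (Fin N) (Fin N) ℂ) := fun μ x => hGU (mem_of_reg335P (G := G) i hreg μ x)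
  have hVu : ∀ x μ, V x μ ∈ unitaryUnits (Matrix (Fin N) (Fin N) ℂ) := fun x μ => retrCfg_mem (fun x μ => liftCfg_mem hU x μ) x μ
  have h52 : pdev V < α₀' * ((((ℓ + 1 : ℕ) : ℝ) ^ j)⁻¹) ^ 2 := pdev_retract_bond_lt i hG1 U hc hMα hreg hK ι
  have hW : ∀ n < j, ∀ (z' : LSite (d + 1)) (κ' : Fin (d + 1)) (r : Fin (d + 1) → Fin (ℓ + 1)),
      ‖((Wcx (ℓ + 1) (avgIter (ℓ + 1) V n) (((ℓ + 1 : ℕ) : ℤ) • z') κ' (boxVec (ℓ + 1) r) : (Matrix (Fin N) (Fin N) ℂ)ˣ) :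
        Matrix (Fin N) (Fin N) ℂ) - 1‖ < 1 := fun n hn z' κ' r =>
    Wcx_avgIter_lt_one (ℓ + 1) hL2 (avgClosed_unitaryUnits (d + 1) (ℓ + 1)) j V hVu hα' hα3 hα2 h52 n hn.le _ κ' r
  -- Step 1: file 2's unfolding, then move `Q_j` to the retraction (locality in `U♯` and in the bond field)
  have hBB : AgreeOn lo hi (fun x μ => covDerivFwd 1 (liftCfg U) μ (liftL i Φ) x) (fun x μ => covDerivFwd 1 V μ (liftL i Φ) x) :=
    fun x μ hx hxe => covDerivFwd_congr_bond (hagree x μ hx hxe) _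
  rw [QknitY_apply, liftBd_gradY, linCovIterC_smul, Pi.smul_apply, Pi.smul_apply, smul_smul, ← Complex.ofReal_mul,
    linCovIterC_congr (ℓ + 1) hL1 j z κ hagree hBB, eq3115C (ℓ + 1) V hL1 (liftL i Φ) j hW z κ]
  -- Step 2: `Q′_j(Û)Φ♯` at the two end labels reads `Û = U♯` on their blocks
  have hLj0 : (0 : ℤ) ≤ ((ℓ : ℤ) + 1) ^ j := by positivity
  have hq0 : QprimeIter (zdBlocking (d + 1) (ℓ + 1)) (bgT (ℓ + 1) V) j (liftL i Φ) z
      = QprimeIter (zdBlocking (d + 1) (ℓ + 1)) (bgT (ℓ + 1) (liftCfg U)) j (liftL i Φ) z := by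
    refine QprimeIter_bgT_congr_bg hL1 j (liftL i Φ) z (hagree.symm.mono (fun μ => ?_) (fun μ => ?_))
    · simp only [hlo, loK, blockBase]; push_cast; exact le_rfl
    · simp only [hhi, bondHiK, blockBase, Pi.add_apply, Pi.smul_apply, Pi.one_apply, smul_eq_mul, mul_one]
      push_cast; split_ifs <;> linarith
  have hq1 : QprimeIter (zdBlocking (d + 1) (ℓ + 1)) (bgT (ℓ + 1) V) j (liftL i Φ) (z + e κ)
      = QprimeIter (zdBlocking (d + 1) (ℓ + 1)) (bgT (ℓ + 1) (liftCfg U)) j (liftL i Φ) (z + e κ) := by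
    refine QprimeIter_bgT_congr_bg hL1 j (liftL i Φ) (z + e κ) (hagree.symm.mono (fun μ => ?_) (fun μ => ?_))
    · simp only [hlo, loK, blockBase, Pi.add_apply, e_apply]
      push_cast; split_ifs <;> nlinarith
    · simp only [hhi, bondHiK, blockBase, Pi.add_apply, Pi.smul_apply, Pi.one_apply, smul_eq_mul, mul_one, e_apply]
      push_cast; split_ifs <;> nlinarith
  have hcd : ∀ (W : LSite (d + 1) → Fin (d + 1) → (Matrix (Fin N) (Fin N) ℂ)ˣ) (f : LSite (d + 1) → Matrix (Fin N) (Fin N) ℂ),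
      covDerivFwd 1 W κ f z = conjR (W z κ) (f (z + e κ)) - f z := fun W f => by simp [covDerivFwd]
  rw [hcd, hq0, hq1]

/-- ★★ **ON (3.35): `Q′(U; parKnitY)Φ = 0 ⇒ Q(U)(D_UΦ) = 0`** — print's sentence after (3.115), for the member's LOCAL class (no global (52)).
[cite: Balaban1985BackgroundPropagators, p.418 (after (3.115)), (3.124) p.420, (3.35) p.396] -/
theorem QknitY_gradY_eq_zero_of_QpY_eq_zero_of_reg335P (hG1 : ∀ u : (Matrix (Fin N) (Fin N) ℂ)ˣ, u ∈ G → ‖(u : Matrix (Fin N) (Fin N) ℂ)‖ ≤ 1)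
    (hGU : G ≤ unitaryUnits (Matrix (Fin N) (Fin N) ℂ))
    (U : CfgY (Matrix (Fin N) (Fin N) ℂ) i) {c₀ α₀ : ℝ} (hc : c₀ ≤ 10) (hMα : 0 ≤ (kGeo i).M * α₀)
    (hreg : (bg9KP (Matrix (Fin N) (Fin N) ℂ) G i).Reg335 c₀ α₀ U) {α₀' : ℝ} (hα' : 0 < α₀') (hα3 : C0 (d + 1) * α₀' ≤ 1 / 3)
    (hα2 : 2 * α₀' ≤ c2' (d + 1) (ℓ + 1)) (hK : Kpl i ((kGeo i).M * α₀) * (kGeo i).L ^ 4 < α₀') (Φ : SiteY i → Matrix (Fin N) (Fin N) ℂ)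
    (hQ : QpY i (parKnitY i) U Φ = 0) : QknitY i U (gradY i U Φ) = 0 := by
  funext ι
  rw [QknitY_gradY_apply_retract i hG1 hGU U hc hMα hreg hα' hα3 hα2 hK Φ ι, QprimeIter_liftL_zSrc_eq_zero i U Φ hQ ι,
    QprimeIter_liftL_zSrc_add_e_eq_zero i U Φ hQ ι, Pi.zero_apply, sub_zero]
  simp [conjR_apply]

end Bond

/-! ## §5 `hZ` at the knit pair on print's class (3.35) -/

section HZ

open scoped Matrix Matrix.Norms.L2Operator

variable {N : ℕ} [Nonempty (Fin N)] (i : KIdx d ℓ hd hL b₀ b₁) {G : Subgroup (Matrix (Fin N) (Fin N) ℂ)ˣ}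

/-- ★★★ **`hZ` AT THE KNIT PAIR ON (3.35), lattice-units `G′`**: `Q(U) ∘ D_U ∘ G′(U) ∘ R(U) = 0` for `Q = QknitY`, `G′, R` at `parKnitY`, for EVERY background of the
member's class `(bg9KP …).Reg335 c₀ α₀` with `G ≤ U(N)` unit-bounded, `c₀ ≤ 10`, `0 ≤ Mα₀`, and the x-free numerics `K_pl(Mα₀)·L⁴ < α₀′`, `C₀α₀′ ≤ 1/3`, `2α₀′ ≤ c₂′`
— p. 426 «QDG′R = D̄Q′G′R = 0»: §3 (knit legs unitary ⇒ J-B's «Q′G′R = 0») + §4. [cite: Balaban1985BackgroundPropagators, p.426, (3.124) p.420, (3.115) p.418, (3.35) p.396, (3.25) p.394] -/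
theorem QknitY_gradY_GpY_RY_parKnitY_of_reg335P (hG1 : ∀ u : (Matrix (Fin N) (Fin N) ℂ)ˣ, u ∈ G → ‖(u : Matrix (Fin N) (Fin N) ℂ)‖ ≤ 1)
    (hGU : G ≤ unitaryUnits (Matrix (Fin N) (Fin N) ℂ))
    {U : CfgY (Matrix (Fin N) (Fin N) ℂ) i} {c₀ α₀ : ℝ} (hc : c₀ ≤ 10) (hMα : 0 ≤ (kGeo i).M * α₀)
    (hreg : (bg9KP (Matrix (Fin N) (Fin N) ℂ) G i).Reg335 c₀ α₀ U) {α₀' : ℝ} (hα' : 0 < α₀') (hα3 : C0 (d + 1) * α₀' ≤ 1 / 3)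
    (hα2 : 2 * α₀' ≤ c2' (d + 1) (ℓ + 1)) (hK : Kpl i ((kGeo i).M * α₀) * (kGeo i).L ^ 4 < α₀') :
    QknitY i U ∘ₗ gradY i U ∘ₗ GpY i (parKnitY i) U ∘ₗ RY i (parKnitY i) (GpY i (parKnitY i)) U = 0 := by
  have hU : ∀ μ x, U μ x ∈ unitaryUnits (Matrix (Fin N) (Fin N) ℂ) := fun μ x => hGU (mem_of_reg335P (G := G) i hreg μ x)
  have hpar := parKnitY_mem_unitary_of_reg335P i hG1 hGU U hc hMα hreg hα' hα3 hα2 hK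
  apply LinearMap.ext
  intro φ
  have hQ : QpY i (parKnitY i) U ((GpY i (parKnitY i) U ∘ₗ RY i (parKnitY i) (GpY i (parKnitY i)) U) φ) = 0 := by
    have h := LinearMap.congr_fun (QpY_GpY_RY_parKnitY i (G := unitaryUnits _) le_rfl hU hpar) φ
    rwa [LinearMap.zero_apply] at h
  rw [LinearMap.zero_apply, LinearMap.comp_apply, LinearMap.comp_apply]
  exact QknitY_gradY_eq_zero_of_QpY_eq_zero_of_reg335P i hG1 hGU U hc hMα hreg hα' hα3 hα2 hK _ hQ

/-- ★★★ **`hZ` AT THE KNIT PAIR ON (3.35), print-units `G′_phys = η²G′`** — THE CERTIFICATE's BINDER SHAPE at the pair (`QknitY`, `parKnitY`):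
`QknitY i U ∘ₗ gradY i U ∘ₗ GpPhysY i (parKnitY i) U ∘ₗ RY i (parKnitY i) (GpPhysY i (parKnitY i)) U = 0` for every `U` of the class (3.35).
[cite: Balaban1985BackgroundPropagators, p.426 («QG₁DR = QDG′R = D̄Q′G′R = 0»), (3.124) p.420, (3.115) p.418, (3.35) p.396, (3.25) p.394] -/
theorem QknitY_gradY_GpPhysY_RY_parKnitY_of_reg335P (hG1 : ∀ u : (Matrix (Fin N) (Fin N) ℂ)ˣ, u ∈ G → ‖(u : Matrix (Fin N) (Fin N) ℂ)‖ ≤ 1)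
    (hGU : G ≤ unitaryUnits (Matrix (Fin N) (Fin N) ℂ))
    {U : CfgY (Matrix (Fin N) (Fin N) ℂ) i} {c₀ α₀ : ℝ} (hc : c₀ ≤ 10) (hMα : 0 ≤ (kGeo i).M * α₀)
    (hreg : (bg9KP (Matrix (Fin N) (Fin N) ℂ) G i).Reg335 c₀ α₀ U) {α₀' : ℝ} (hα' : 0 < α₀') (hα3 : C0 (d + 1) * α₀' ≤ 1 / 3)
    (hα2 : 2 * α₀' ≤ c2' (d + 1) (ℓ + 1)) (hK : Kpl i ((kGeo i).M * α₀) * (kGeo i).L ^ 4 < α₀') :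
    QknitY i U ∘ₗ gradY i U ∘ₗ GpPhysY i (parKnitY i) U ∘ₗ RY i (parKnitY i) (GpPhysY i (parKnitY i)) U = 0 := by
  rw [RY_GpPhysY, GpPhysY_apply, LinearMap.smul_comp, LinearMap.comp_smul, LinearMap.comp_smul,
    QknitY_gradY_GpY_RY_parKnitY_of_reg335P i hG1 hGU hc hMα hreg hα' hα3 hα2 hK, smul_zero]

end HZ

end Literature.MathematicalPhysics.QuantumFieldTheory.Balaban1983to89.B9Eq3124HZKnitPairReg335Y

end
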